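import Literature.Topology.FourManifolds.FoldPushModel
import HarnessLib

/-!
# Pushing a fold arc: the plane map `T_θ` is a local diffeomorphism for small `θ`

Topic `Literature/Topology/FourManifolds` (programme of the fact
`Literature.Topology.FourManifolds.exists_isSimplifiedBrokenLefschetzFibration`, Baykur–Saeki 2017, §2.1,
§3).  Companion of `FoldPushModel`: near the axis the pushed fold model is `T_θ ∘ F₀` with
`T_θ(w) = w + β₁(w₀) θ` (`FoldPush.pushPlaneMap`).  Its differential at `w` is
`v ↦ v + β₁'(w₀) v₀ θ`, triangular with diagonal `(1 + θ₀ β₁'(w₀), 1)`, hence invertible as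
soon as `|θ₀| · sup |β₁'| < 1`; by the inverse function theorem `T_θ` is then a local
diffeomorphism at every point of the plane, uniformly in `‖θ‖ < ε`.  This provides the target
charts `ψ ∘ T_θ⁻¹` in which the pushed map is again the fold model.

* `FoldPush.hasFDerivAt_pushPlaneMap`, `FoldPush.exists_pushPlane_localInverse`.

Everything is proved; no new definitions besides the differential; no named facts (D-0026).

## References

* R. İ. Baykur, O. Saeki, *Simplifying indefinite fibrations on 4-manifolds*, arXiv:1705.11169,
  §2.1, §3. [BaykurSaeki2017]
* M. Golubitsky, V. Guillemin, *Stable Mappings and Their Singularities*, GTM 14 (1973), Ch. I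
  §1 (inverse function theorem). [GolubitskyGuillemin1973]
-/

noncomputable section

set_option maxSynthPendingDepth 2

open Set Function Filter Module Metric
open scoped ContDiff Topology

namespace Literature.Topology.FourManifolds

/-- Local notation: `𝔼 n` is the model Euclidean space `EuclideanSpace ℝ (Fin n)`. -/
local notation "𝔼 " n:arg => EuclideanSpace ℝ (Fin n)

/-- Local notation: the coordinate covectors of `ℝ²`. -/
local notation "π₂" => (EuclideanSpace.proj (𝕜 := ℝ) (ι := Fin 2))

namespace FoldPush

variable (β₁ : ContDiffBump (0 : ℝ))

/-- The differential of `T_θ` at `w`: `v ↦ v + β₁'(w₀) v₀ θ`. [folklore] -/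
def pushPlaneDeriv (θ w : 𝔼 2) : 𝔼 2 →L[ℝ] 𝔼 2 :=
  ContinuousLinearMap.id ℝ (𝔼 2) + (deriv β₁ (w 0) • π₂ 0).smulRight θ

/-- `pushPlaneDeriv θ w v = v + (β₁'(w₀) v₀) θ`. [folklore] -/
@[simp] theorem pushPlaneDeriv_apply (θ w v : 𝔼 2) :
    pushPlaneDeriv β₁ θ w v = v + (deriv β₁ (w 0) * v 0) • θ := by
  simp [pushPlaneDeriv, ContinuousLinearMap.smulRight_apply]

/-- `T_θ` is `C^∞`. [folklore] -/
theorem contDiff_pushPlaneMap (θ : 𝔼 2) : ContDiff ℝ ∞ (pushPlaneMap β₁ θ) :=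
  contDiff_id.add ((β₁.contDiff.comp (π₂ 0).contDiff).smul contDiff_const)

/-- The differential of `T_θ`. [folklore] -/
theorem hasFDerivAt_pushPlaneMap (θ w : 𝔼 2) :
    HasFDerivAt (pushPlaneMap β₁ θ) (pushPlaneDeriv β₁ θ w) w := by
  have hb : HasFDerivAt (fun z : 𝔼 2 => β₁ (z 0))
      ((ContinuousLinearMap.smulRight (1 : ℝ →L[ℝ] ℝ) (deriv β₁ (w 0))).comp (π₂ 0)) w :=
    ((β₁.contDiff (n := ⊤)).differentiable (by simp) _).hasDerivAt.hasFDerivAt.comp w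
      (π₂ 0).hasFDerivAt
  refine ((hasFDerivAt_id w).add (hb.smul_const θ)).congr_fderiv ?_
  ext v i
  simp [pushPlaneDeriv, ContinuousLinearMap.smulRight_apply, mul_comm]

/-- The differential of `T_θ` is injective when `1 + θ₀ β₁'(w₀) ≠ 0`. [folklore] -/
theorem injective_pushPlaneDeriv {θ w : 𝔼 2} (hc : 1 + θ 0 * deriv β₁ (w 0) ≠ 0) :
    Injective (pushPlaneDeriv β₁ θ w) := by
  intro v v' hvv'
  rw [← sub_eq_zero] at hvv' ⊢
  rw [← map_sub] at hvv'
  set u := v - v' with hu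
  have h0 := congrArg (fun z : 𝔼 2 => z 0) hvv'
  have h1 := congrArg (fun z : 𝔼 2 => z 1) hvv'
  simp only [pushPlaneDeriv_apply, PiLp.add_apply, PiLp.smul_apply, smul_eq_mul,
    PiLp.zero_apply] at h0 h1
  have hu0 : u 0 = 0 := by
    have : (1 + θ 0 * deriv β₁ (w 0)) * u 0 = 0 := by linear_combination h0
    exact (mul_eq_zero.1 this).resolve_left hc
  have hu1 : u 1 = 0 := by
    rw [hu0, mul_zero, zero_mul, add_zero] at h1
    exact h1
  ext i
  fin_cases i
  · simpa using hu0
  · simpa using hu1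

/-- **`T_θ` is a local diffeomorphism at every point, uniformly for small `θ`.**  There is
`ε > 0` such that for `‖θ‖ < ε` and every `w ∈ ℝ²` the map `T_θ(w) = w + β₁(w₀)θ` restricts
to a `C^∞` diffeomorphism (an `OpenPartialHomeomorph` with `C^∞` inverse) of a neighbourhood
of `w`. [cite: GolubitskyGuillemin1973, Ch. I §1] -/
theorem exists_pushPlane_localInverse (β₁ : ContDiffBump (0 : ℝ)) :
    ∃ ε > 0, ∀ θ : 𝔼 2, ‖θ‖ < ε → ∀ w : 𝔼 2,
      ∃ G : OpenPartialHomeomorph (𝔼 2) (𝔼 2), ⇑G = pushPlaneMap β₁ θ ∧ w ∈ G.source ∧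
        ContDiffOn ℝ ∞ G G.source ∧ ContDiffOn ℝ ∞ G.symm G.target := by
  obtain ⟨C, hC⟩ := (β₁.contDiff (n := ⊤)).continuous_deriv (by simp)
    |>.bounded_above_of_compact_support β₁.hasCompactSupport.deriv
  refine ⟨1 / (2 * |C| + 2), by positivity, fun θ hθ w => ?_⟩
  -- the differential is invertible
  have hc : 1 + θ 0 * deriv β₁ (w 0) ≠ 0 := by
    have h1 : |deriv β₁ (w 0)| ≤ |C| := (hC (w 0)).trans (le_abs_self C)
    have h2 : |θ 0| ≤ ‖θ‖ := by simpa using PiLp.norm_apply_le θ 0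
    have h3 : |θ 0 * deriv β₁ (w 0)| < 1 / 2 := by
      rw [abs_mul]
      calc |θ 0| * |deriv β₁ (w 0)| ≤ ‖θ‖ * |C| := by gcongr
        _ ≤ 1 / (2 * |C| + 2) * |C| := by gcongr
        _ < 1 / 2 := by
          rw [div_mul_eq_mul_div, one_mul, div_lt_div_iff₀ (by positivity) (by positivity)]
          linarith [abs_nonneg C]
    intro h0
    have : θ 0 * deriv β₁ (w 0) = -1 := by linarith
    rw [this, abs_neg, abs_one] at h3
    norm_num at h3
  have hinj := injective_pushPlaneDeriv β₁ hc
  set L : (𝔼 2) ≃L[ℝ] 𝔼 2 :=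
    (LinearMap.linearEquivOfInjective
      ((pushPlaneDeriv β₁ θ w : 𝔼 2 →L[ℝ] 𝔼 2) : 𝔼 2 →ₗ[ℝ] 𝔼 2) hinj rfl).toContinuousLinearEquiv
    with hL
  have hLc : (L : 𝔼 2 →L[ℝ] 𝔼 2) = pushPlaneDeriv β₁ θ w := ContinuousLinearMap.ext fun _ => rfl
  have hd : HasFDerivAt (pushPlaneMap β₁ θ) (L : 𝔼 2 →L[ℝ] 𝔼 2) w := by
    rw [hLc]
    exact hasFDerivAt_pushPlaneMap β₁ θ w
  obtain ⟨G, hG, hw, -, hGs, hGss⟩ := exists_openPartialHomeomorph_contDiffOn_symm isOpen_univ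
    (mem_univ w) (by simp) (contDiff_pushPlaneMap β₁ θ).contDiffOn L hd
  exact ⟨G, hG, hw, hGs, hGss⟩

end FoldPush

end Literature.Topology.FourManifolds
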